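import Summits.CriticalPhenomena.PercolationContinuityZ3.Theorems.PercNearOneGluingNoHeavyConstsIntervalLawEmptyRow
import HarnessLib

/-!
# The ADMISSIBILITY conjecture for marker dominance under avoidance conditioning (typed; `A = ∅` case proved; ⟹ the interval law)
# (PAPER-2 track (ii): constants of the CSH family; seat `prim-consts-2`, gen 13)

builds on p205010 (kernel theorem, internal audit signed; external expert review pending).  Support file (`--supports
stmt-CriticalPhenomena-4575`); memo `run/shared/lean/prim/consts/FROM-prim-consts-2-g13-ADMISSIBILITY.md` §2–§3.  One `Prop` definition
(an OPEN conjecture, tagged `@[conjecture]`); theorems; no sorries; standard axioms.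

Setting: finite weighted graph, owner `s`, markers `y, z` (`Y = {s↔y}`, `Z = {s↔z}`, `W = {y↔z}`), vertex sets `C ⊇ A`, `E ⊇ A`
(`R_A = {s ↮ A}`, `K_A = μ(R_A)`, `ν_A = μ(·|R_A)`), and an UP-EVENT `U` of the cluster `C_s` (closed under enlarging the open edge cluster
of `s`) which contains the hitting event `{s ↔ E∖A}` (on `R_A`: `Uᶜ ∩ R_A ⊆ R_E`).  Write `θ(C,E) := P(y↔z | y ↮ {s}∪C, s ↮ E)`.

* `Consts.AvoidanceAdmissibility` — **CONJECTURE ADM (gen 13)**: `θ(C,E)` is an ADMISSIBLE marker-dominance constant for `U` under `ν_A`: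
  `μ(T∩W)·[K_A·μ(R_A∩U∩Y) − μ(R_A∩U)·μ(R_A∩Y)] ≤ μ(T)·[K_A·μ(R_A∩U∩Z) − μ(R_A∩U)·μ(R_A∩Z)]`, `T = {y ↮ {s}∪C} ∩ R_E`
  (the brackets are `K_A²·Cov_{ν_A}(1_U, 1_Y)` and `K_A²·Cov_{ν_A}(1_U, 1_Z)`).  Dictionary: `C = E = A`, all `U` — `Consts.MDLXJoint` at indicator
  functionals (constant `p′(A)`); `U = {s ↔ B∖A}`, `A ⊆ C ⊆ E = B` — the interval law `Consts.AvoidanceIntervalLaw` at `(A,B;C)`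
  (`Consts.intervalLaw_of_admissibility`); `C = A`, `E = A ∪ B′`, `U = {s↔B′}` — the top edge with the constant `P(W | T_A, s↮B′)`.
  No inclusion between `C` and `E` is required (the census covers `C ⊋ E` and `C`, `E` incomparable: 0 violations as well).
  EVIDENCE (exact recheck of every float candidate; kit j168349 + j168543, n = 6…9, corner/dense/generic palettes; min over ALL admissible up-sets `U` by a
  closure/max-flow problem on the realised cluster poset): 0 violations / 9.4·10⁴ `(graph, C, E)` at n ≤ 8 (+ the n = 8, 9 run), and 0 on all 840
  placements of the seven-vertex three-way-separation witness of `Consts.not_threeSep_posCorrelation`; the controls fail as they must: dropping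
  `y ↮ A` from the constant, i.e. `C ⊉ A` (13–28 %), weakening the forcing `U ⊇ {s↔E∖A}` (1–11 %).  The constants are NOT ordered among themselves
  (`P(W | T_A, s↮b) < P(W | T_{A∪b})` occurs, memo §3), so ADM does not reduce to one of its corners.
* `Consts.avoidanceAdmissibility_empty` — **the case `A = ∅` HOLDS** (every `C, E`, every up-event `U ⊇ {s↔E}`): `Consts.adm_empty`.
* `Consts.intervalLaw_of_admissibility` — ADM ⟹ `Consts.AvoidanceIntervalLaw`.
[cite: VandenbergHaggstromKahn2005, Thm. 1.1 (p. 3), Thm. 1.3 (p. 6), Thm. 2.1 (p. 9)] [status: open]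
-/

noncomputable section

namespace Summit.CriticalPhenomena.PercolationContinuityZ3.Theorems

open MeasureTheory Set Literature.Probability.LatticeModels Literature.Probability.Percolation
open scoped Classical

namespace Consts

variable {V : Type*} [Fintype V]

/-- **CONJECTURE ADM — admissibility of the three-way constants `P(y↔z | y↮{s}∪C, s↮E)` (gen 13).**  For every finite weighted graph, `s, y, z`,
vertex sets `C ⊇ A`, `E ⊇ A` and every up-event `U` of the open edge cluster of `s` with `Uᶜ ∩ {s↮A} ⊆ {s↮E}`:
`μ(T∩W)·[K_A μ(R_A∩U∩Y) − μ(R_A∩U) μ(R_A∩Y)] ≤ μ(T)·[K_A μ(R_A∩U∩Z) − μ(R_A∩U) μ(R_A∩Z)]`, `T = {y ↮ {s}∪C} ∩ {s ↮ E}`.  OPEN for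
`A ≠ ∅` (contains `Consts.MDLXJoint` at indicator functionals and `Consts.AvoidanceIntervalLaw`); the case `A = ∅` is
`Consts.avoidanceAdmissibility_empty`.  builds on p205010 (kernel theorem, internal audit signed; external expert review pending).
[cite: VandenbergHaggstromKahn2005, Thm. 1.1 (p. 3), Thm. 1.3 (p. 6), Thm. 2.1 (p. 9)] [status: open] -/
@[conjecture] def AvoidanceAdmissibility : Prop :=
  ∀ (n : ℕ) (w : Sym2 (Fin n) → unitInterval) (s y z : Fin n) (A C E : Set (Fin n)) (U : Set (BondConfig (Fin n))),
    A ⊆ C → A ⊆ E →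
    (∀ ⦃ω ω' : BondConfig (Fin n)⦄, openEdgeCluster ω s ⊆ openEdgeCluster ω' s → ω ∈ U → ω' ∈ U) →
    (∀ ω : BondConfig (Fin n), ω ∉ U → (∀ a ∈ A, ¬ (openGraph ω).Reachable s a) → ∀ e ∈ E, ¬ (openGraph ω).Reachable s e) →
    (prodBernoulli w).real ({ω : BondConfig (Fin n) | ∀ t ∈ insert s C, ¬ (openGraph ω).Reachable y t} ∩
        {ω | ∀ e ∈ E, ¬ (openGraph ω).Reachable s e} ∩ openConn y z) *
      ((prodBernoulli w).real {ω : BondConfig (Fin n) | ∀ a ∈ A, ¬ (openGraph ω).Reachable s a} *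
          (prodBernoulli w).real ({ω : BondConfig (Fin n) | ∀ a ∈ A, ¬ (openGraph ω).Reachable s a} ∩ U ∩ openConn s y) -
        (prodBernoulli w).real ({ω : BondConfig (Fin n) | ∀ a ∈ A, ¬ (openGraph ω).Reachable s a} ∩ U) *
          (prodBernoulli w).real ({ω : BondConfig (Fin n) | ∀ a ∈ A, ¬ (openGraph ω).Reachable s a} ∩ openConn s y)) ≤
    (prodBernoulli w).real ({ω : BondConfig (Fin n) | ∀ t ∈ insert s C, ¬ (openGraph ω).Reachable y t} ∩
        {ω | ∀ e ∈ E, ¬ (openGraph ω).Reachable s e}) *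
      ((prodBernoulli w).real {ω : BondConfig (Fin n) | ∀ a ∈ A, ¬ (openGraph ω).Reachable s a} *
          (prodBernoulli w).real ({ω : BondConfig (Fin n) | ∀ a ∈ A, ¬ (openGraph ω).Reachable s a} ∩ U ∩ openConn s z) -
        (prodBernoulli w).real ({ω : BondConfig (Fin n) | ∀ a ∈ A, ¬ (openGraph ω).Reachable s a} ∩ U) *
          (prodBernoulli w).real ({ω : BondConfig (Fin n) | ∀ a ∈ A, ¬ (openGraph ω).Reachable s a} ∩ openConn s z))

/-- **ADM holds for `A = ∅`** (every graph on any finite vertex type, all `C, E`, every up-event `U` of `C_s` with `Uᶜ ⊆ {s↮E}`):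
`μ(T∩W)·[μ(U∩Y) − μ(U)μ(Y)] ≤ μ(T)·[μ(U∩Z) − μ(U)μ(Z)]`, `T = {y ↮ {s}∪C} ∩ {s ↮ E}` — `Consts.adm_empty` rewritten for the up-event
`U = Dᶜ`.  [cite: VandenbergHaggstromKahn2005, Thm. 1.3 (p. 6), Thm. 2.1 (p. 9) — corollary, derived here] -/
theorem avoidanceAdmissibility_empty (w : Sym2 V → unitInterval) (s y z : V) (C E : Set V) {U : Set (BondConfig V)}
    (hU : ∀ ⦃ω ω' : BondConfig V⦄, openEdgeCluster ω s ⊆ openEdgeCluster ω' s → ω ∈ U → ω' ∈ U)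
    (hUE : ∀ ω : BondConfig V, ω ∉ U → ∀ e ∈ E, ¬ (openGraph ω).Reachable s e) :
    (prodBernoulli w).real ({ω : BondConfig V | ∀ t ∈ insert s C, ¬ (openGraph ω).Reachable y t} ∩
        {ω | ∀ e ∈ E, ¬ (openGraph ω).Reachable s e} ∩ openConn y z) *
      ((prodBernoulli w).real (U ∩ openConn s y) - (prodBernoulli w).real U * (prodBernoulli w).real (openConn s y)) ≤
    (prodBernoulli w).real ({ω : BondConfig V | ∀ t ∈ insert s C, ¬ (openGraph ω).Reachable y t} ∩
        {ω | ∀ e ∈ E, ¬ (openGraph ω).Reachable s e}) *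
      ((prodBernoulli w).real (U ∩ openConn s z) - (prodBernoulli w).real U * (prodBernoulli w).real (openConn s z)) := by
  classical
  set μ := prodBernoulli w with hμ
  have hmeas : ∀ S : Set (BondConfig V), MeasurableSet S := fun _ => MeasurableSet.of_discrete
  have hD : ∀ ⦃ω ω' : BondConfig V⦄, openEdgeCluster ω' s ⊆ openEdgeCluster ω s → ω ∈ Uᶜ → ω' ∈ Uᶜ :=
    fun ω ω' hsub hω hω' => hω (hU hsub hω')
  have hDE : Uᶜ ⊆ {ω : BondConfig V | ∀ e ∈ E, ¬ (openGraph ω).Reachable s e} := fun ω hω => hUE ω hω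
  have key := adm_empty w s y z C E hD hDE
  -- `μ(Uᶜ)μ(X) − μ(Uᶜ ∩ X) = μ(U ∩ X) − μ(U)μ(X)` for any event `X`
  have conv : ∀ X : Set (BondConfig V), μ.real Uᶜ * μ.real X - μ.real (Uᶜ ∩ X) = μ.real (U ∩ X) - μ.real U * μ.real X := by
    intro X
    have h1 := measureReal_inter_add_sdiff (μ := μ) (s := X) (hmeas U)
    have e1 : X ∩ U = U ∩ X := inter_comm X U
    have e2 : X \ U = Uᶜ ∩ X := by ext ω; simp only [mem_sdiff, mem_inter_iff, mem_compl_iff]; tauto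
    rw [e1, e2] at h1
    have h2 := probReal_compl_eq_one_sub (μ := μ) (hmeas U)
    rw [h2]; linarith
  rw [← conv, ← conv]
  exact key

/-- **ADM ⟹ the interval law.**  `Consts.AvoidanceIntervalLaw` at `(A, B; C)` (`A ⊆ C ⊆ B`) is ADM at `(A; C, E := C)` with the hitting
event `U = {s ↔ B}` (`Uᶜ = R_B ⊆ R_C`); the covariance brackets become the gaps `K_AK_{B∪t} − K_BK_{A∪t}` by inclusion–exclusion
(`Consts.real_avoid_inter_conn_eq`). [cite: VandenbergHaggstromKahn2005, Thm. 1.1 (p. 3) — bookkeeping, derived here] -/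
theorem intervalLaw_of_admissibility (h : AvoidanceAdmissibility) : AvoidanceIntervalLaw := by
  intro n w s y z A B C hAC hCB
  classical
  set μ := prodBernoulli w with hμ
  have hmeas : ∀ S : Set (BondConfig (Fin n)), MeasurableSet S := fun _ => MeasurableSet.of_discrete
  set RA : Set (BondConfig (Fin n)) := {ω | ∀ a ∈ A, ¬ (openGraph ω).Reachable s a} with hRA
  set RB : Set (BondConfig (Fin n)) := {ω | ∀ x ∈ B, ¬ (openGraph ω).Reachable s x} with hRB
  set U : Set (BondConfig (Fin n)) := RBᶜ with hUdef
  have hU : ∀ ⦃ω ω' : BondConfig (Fin n)⦄, openEdgeCluster ω s ⊆ openEdgeCluster ω' s → ω ∈ U → ω' ∈ U := by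
    intro ω ω' hsub hω hω'
    exact hω fun x hx hr => hω' x hx (reachable_of_openEdgeCluster_subset s x hsub hr)
  have hUE : ∀ ω : BondConfig (Fin n), ω ∉ U → (∀ a ∈ A, ¬ (openGraph ω).Reachable s a) → ∀ e ∈ C, ¬ (openGraph ω).Reachable s e := by
    intro ω hω _ e he
    have hω' : ω ∈ RB := not_not.1 hω
    exact hω' e (hCB he)
  have key := h n w s y z A C C U hAC hAC hU hUE
  -- rewrite the brackets: `R_A ∩ U = R_A \ R_B` (as `B ⊇ A`), `μ(R_A ∩ U ∩ {s↔t}) = (K_A − K_{A∪t}) − (K_B − K_{B∪t})`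
  have hBA : RB ⊆ RA := fun ω hω a ha => hω a (hCB (hAC ha))
  have eU : μ.real (RA ∩ U) = μ.real RA - μ.real RB := by
    have h1 := measureReal_inter_add_sdiff (μ := μ) (s := RA) (hmeas RB)
    rw [inter_eq_right.2 hBA] at h1
    have e : RA \ RB = RA ∩ U := by ext ω; simp only [mem_sdiff, mem_inter_iff, hUdef, mem_compl_iff]
    rw [e] at h1; linarith
  have eUt : ∀ t : Fin n, μ.real (RA ∩ U ∩ openConn s t) = μ.real (RA ∩ openConn s t) - μ.real (RB ∩ openConn s t) := by
    intro t
    have h1 := measureReal_inter_add_sdiff (μ := μ) (s := RA ∩ openConn s t) (hmeas RB)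
    have e1 : RA ∩ openConn s t ∩ RB = RB ∩ openConn s t := by
      ext ω; simp only [mem_inter_iff]
      exact ⟨fun h => ⟨h.2, h.1.2⟩, fun h => ⟨⟨hBA h.1, h.2⟩, h.1⟩⟩
    have e2 : (RA ∩ openConn s t) \ RB = RA ∩ U ∩ openConn s t := by
      ext ω; simp only [mem_sdiff, mem_inter_iff, hUdef, mem_compl_iff]; tauto
    rw [e1, e2] at h1; linarith
  have eAt : ∀ t : Fin n, μ.real (RA ∩ openConn s t) =
      μ.real RA - μ.real {ω : BondConfig (Fin n) | ∀ x ∈ insert t A, ¬ (openGraph ω).Reachable s x} := fun t =>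
    real_avoid_inter_conn_eq w s t A
  have eBt : ∀ t : Fin n, μ.real (RB ∩ openConn s t) =
      μ.real RB - μ.real {ω : BondConfig (Fin n) | ∀ x ∈ insert t B, ¬ (openGraph ω).Reachable s x} := fun t =>
    real_avoid_inter_conn_eq w s t B
  rw [eU, eUt, eUt, eAt, eAt, eBt, eBt] at key
  have e1 : ∀ (kA kB kAt kBt : ℝ), kA * (kA - kAt - (kB - kBt)) - (kA - kB) * (kA - kAt) = kA * kBt - kB * kAt := by
    intros; ring
  rw [e1, e1] at key
  exact key

end Consts

end Summit.CriticalPhenomena.PercolationContinuityZ3.Theorems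

end
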